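import Summits.BirchSwinnertonDyer.Rank1Residual.F1Sign2.TwistPeriodUnitProofs
import HarnessLib

/-!
# Cell `bsd-f1-sign2`, AN-33w/x/y/z PROOFS (§11–§12): every minus-symbol unit has `v₂(u) ≤ −1`; the CANONICAL unit `u = ½` away from the level; `η_f` = the bit «`2F_{q₀}(f)` odd» — KERNEL-CHECKED (-an g16, Sketch_v37 §11–§12)

PORT (cell `bsd-f1-sign2`, seat `-ty` g11) of -an g16's tree-rebased file of record `MEMO-an-data/g16/Sketch_v37.lean` 454eaaa5b944aeb6 (= MEMO-an v1.40 /
`Sketch_v36.lean` 335ae8cb61bfaf5b rebased on the tree: imports `F1Sign2/UnitDoorParityAtTwo` + `F1Sign2/TwistedMinusSymbolSumProofs`, the 37 decls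
byte-identical in the tree deleted, the v32-generalised «units AWAY from M» helpers renamed `…_away`; farm rc 0 · 0 err · 0 warn · 0 sorry,
`bc/Sketch_v37_check.json` 6d9656a1424da834; evidence #60 on stmt-23715).  REF1 §126 (refuter-bsd-f1-sign2-ref1 g11, 2026-08-28T17:18:39Z): «§4–§10 Away
generalisation clean; 29/29 new theorems axioms {propext, Classical.choice, Quot.sound}».  Typer edits = this header, the section ranges, added
docstrings on undocumented helpers; proofs VERBATIM.  Nothing here proves BSD; 23715 not closed.
Sections §11–§12 of the port file: AN-33w `padicValRat_le_neg_one_of_isMinusSymbolUnit` (`½ ∈ uℤ` from `im Λ_f = ℤΩ⁻_f/2`), AN-33x glue,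
`eggHalfOddSymbolLawAtTwo_of_eggEtaOneLaw`; AN-33y `isMinusSymbolUnitAway_half` (`{∞, γ0} = {∞, γ∞} + {∞, 0}`; = Cremona §2.8), AN-33z canonical-bit
glue, `eggTwiceHalfSumOddLawAtTwo_of_eggEtaOneLaw`.  REF1 §126: AN-33w/y sound (C9 bookkeeping, no circularity; Manin symbols).  REF2 v36 §1: KNOWN
bookkeeping (Cremona 1997 §2.8/§2.11, Λ_f rectangular (2.8.9)); beyond-print no.  [cite: Cremona1997, §2.8, §2.11]
-/

set_option autoImplicit false

noncomputable section

open scoped Classical MatrixGroups ModularForm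

open CongruenceSubgroup WeierstrassCurve NumberField Literature.NumberTheory.EllipticCurves Literature.NumberTheory.EllipticCurves.ModularForms
  Literature.NumberTheory.EllipticCurves.Rank1Residual
  Literature.NumberTheory.EllipticCurves.Rank1Residual.Typed
  Summit.BirchSwinnertonDyer.Rank1Residual
  Summit.BirchSwinnertonDyer.Rank1Residual.F1Sign2
  Summit.BirchSwinnertonDyer.Rank1Residual.F1Sign2.TranspositionDoor
  Summit.BirchSwinnertonDyer.BirchSwinnertonDyer.Theorems.RankOneAtTwoOneDoor

namespace Summit.BirchSwinnertonDyer.Rank1Residual.F1Sign2.ANg16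

/-! ### §11 AN-33w/x (v31): every minus-symbol unit has `v₂(u) ≤ −1`; the residual is the bare parity bit `η_f = 1`

`im Λ_f = ℤ·Ω⁻_f/2` (`minusPeriod_eq_zero_or` + `IsNewform0.minusPeriod_pos_holds`) and `Λ_f` is generated by the cusp symbols `{∞, γ∞}_f`
(`periodLattice = closure (range cuspSymbol)`), whose imaginary parts are `[γ∞]⁻_f · Ω⁻_f ∈ u·Ω⁻_f·ℤ` (`im_modularSymbol_eq` from
`minusSymbol_eq_im_mul_I_holds` + `ratCast_ratMinusSymbol`); so `Ω⁻_f/2 ∈ u·Ω⁻_f·ℤ`, `½ ∈ uℤ`, `v₂(u) ≤ −1`. -/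

section UnitValuation

variable {N : ℕ} [NeZero N] {f : CuspForm (Gamma0 N) 2}


/-- `im {∞, r}_f = [r]⁻_f · Ω⁻_f` for a rational newform. -/
theorem im_modularSymbol_eq (hf : IsNewform0 f) (hQ : coeffField f = ⊥) (r : ℚ) :
    (modularSymbol f r).im = (ratMinusSymbol f r : ℝ) * minusPeriod f := by
  obtain ⟨hΩ, -⟩ := IsNewform0.exists_rat_smul_minusPeriod_holds (f := f) hf hQ
  have hreal : ∀ n, (cuspCoeff f n).im = 0 := cuspCoeff_im_eq_zero_of_coeffField_eq_bot hQ
  have hM := minusSymbol_eq_im_mul_I_holds f hreal r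
  have him : (minusSymbol f r).im = (modularSymbol f r).im := by
    rw [hM, Complex.mul_im, Complex.ofReal_re, Complex.ofReal_im, Complex.I_re, Complex.I_im]
    ring
  rw [← him, ratCast_ratMinusSymbol f hf hQ r, normalizedMinusSymbol, div_mul_cancel₀ _ hΩ]

/-- Every period of `f` has imaginary part in `u·Ω⁻_f·ℤ` for a symbol unit `u`. -/
theorem exists_int_im_eq_of_mem_periodLattice (hf : IsNewform0 f) (hQ : coeffField f = ⊥) {u : ℚ}
    (hu : IsMinusSymbolUnit f u) {z : ℂ} (hz : z ∈ periodLattice f) :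
    ∃ m : ℤ, z.im = m * (u : ℝ) * minusPeriod f := by
  induction hz using AddSubgroup.closure_induction with
  | mem x hx =>
    obtain ⟨γ, rfl⟩ := hx
    unfold cuspSymbol
    split_ifs with h
    · exact ⟨0, by simp⟩
    · obtain ⟨zz, hzz⟩ := hu.2 ((((γ : SL(2, ℤ)) 0 0 : ℤ) : ℚ) / (((γ : SL(2, ℤ)) 1 0 : ℤ) : ℚ))
      refine ⟨zz, ?_⟩
      rw [im_modularSymbol_eq hf hQ, hzz]
      push_cast
      ring
  | zero => exact ⟨0, by simp⟩
  | add x y _ _ ihx ihy =>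
    obtain ⟨mx, hx⟩ := ihx
    obtain ⟨my, hy⟩ := ihy
    exact ⟨mx + my, by rw [Complex.add_im, hx, hy]; push_cast; ring⟩
  | neg x _ ih =>
    obtain ⟨m, hm⟩ := ih
    exact ⟨-m, by rw [Complex.neg_im, hm]; push_cast; ring⟩

/-- **`½ ∈ uℤ` for every minus-symbol unit `u`** (`Ω⁻_f/2 ∈ im Λ_f ⊆ u·Ω⁻_f·ℤ`). -/
theorem exists_int_mul_eq_half_of_isMinusSymbolUnit (hf : IsNewform0 f) (hQ : coeffField f = ⊥) {u : ℚ}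
    (hu : IsMinusSymbolUnit f u) : ∃ m : ℤ, (m : ℚ) * u = 1 / 2 := by
  have hpos : 0 < minusPeriod f := IsNewform0.minusPeriod_pos_holds hf hQ
  have him : imagPeriods f = AddSubgroup.zmultiples (minusPeriod f / 2) := by
    rcases minusPeriod_eq_zero_or f with h | ⟨-, h⟩
    · exact absurd h hpos.ne'
    · exact h
  have hmem : minusPeriod f / 2 ∈ imagPeriods f := by
    rw [him]; exact AddSubgroup.mem_zmultiples _
  obtain ⟨z, hz, hzim⟩ := AddSubgroup.mem_map.mp hmem
  obtain ⟨m, hm⟩ := exists_int_im_eq_of_mem_periodLattice hf hQ hu hz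
  have hzim' : z.im = minusPeriod f / 2 := by simpa using hzim
  refine ⟨m, ?_⟩
  have h3 : ((m : ℝ) * (u : ℝ)) * minusPeriod f = (1 / 2) * minusPeriod f := by
    rw [← hm, hzim']; ring
  have h4 := mul_right_cancel₀ hpos.ne' h3
  have h5 : (((m : ℚ) * u : ℚ) : ℝ) = ((1 / 2 : ℚ) : ℝ) := by push_cast; linarith [h4]
  exact Rat.cast_injective h5

/-- **AN-33w (PROVED): every minus-symbol unit has `v₂(u) ≤ −1`.** -/
theorem padicValRat_le_neg_one_of_isMinusSymbolUnit (hf : IsNewform0 f) (hQ : coeffField f = ⊥) {u : ℚ}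
    (hu : IsMinusSymbolUnit f u) : padicValRat 2 u ≤ -1 := by
  obtain ⟨m, hm⟩ := exists_int_mul_eq_half_of_isMinusSymbolUnit hf hQ hu
  have hu0 : u ≠ 0 := ne_of_gt hu.1
  have hm0 : (m : ℚ) ≠ 0 := by
    intro h0; rw [h0, zero_mul] at hm; norm_num at hm
  have hv : padicValRat 2 ((m : ℚ) * u) = -1 := by
    rw [hm, padicValRat.div one_ne_zero two_ne_zero, padicValRat.one]
    have h22 : padicValRat 2 (2 : ℚ) = 1 := by
      have := padicValRat.self (p := 2) one_lt_two
      simpa using this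
    rw [h22]; norm_num
  rw [padicValRat.mul hm0 hu0, padicValRat.of_int] at hv
  have h0 : (0 : ℤ) ≤ (padicValInt 2 m : ℤ) := by positivity
  omega


/-- **AN-33u′ (PROVED): AN-33u without the valuation hypothesis** (`v₂(u) ≤ −1` is automatic by AN-33w). -/
theorem doorUnitValueAt_of_pureCycle_goodAtTwo'
    (hGV : numRealComponents_mul_imaginaryPeriodRat_eq_unit_mul_minusPeriod_two) (hE : hasEntireLFunction_rat)
    (W : WeierstrassCurve ℚ) [W.IsElliptic] [W.IsGloballyMinimal]
    (h2 : W.HasGoodReductionAtPrime 2) (hirr : W.HasIrreducibleModPGaloisRep 2) (hfW : IsNewformOf W f)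
    {u : ℚ} (hu : IsMinusSymbolUnit f u)
    {q₀ : ℕ} {a₀ : ℤ} (hq₀ : q₀.Prime) (hq₀o : Odd q₀) (hq₀N : ¬ q₀ ∣ N) (ha₀ : cuspCoeff f q₀ = (a₀ : ℂ)) (ha₀o : Odd a₀)
    (hη : ∃ z₀ : ℤ, minusHalfSum f q₀ = (2 * z₀ + 1) * u)
    (a : ℕ → ℤ) {d : ℤ} (hd0 : d < 0) (hsq : Squarefree d) (hd4 : d % 4 = 1) (hgcd : Int.gcd d (W.conductorNorm ℤ) = 1)
    (hpr : ∀ q ∈ d.natAbs.primeFactors, ¬ q ∣ N ∧ cuspCoeff f q = (a q : ℂ)) (hpure : ∀ q ∈ d.natAbs.primeFactors, Odd (a q))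
    (Wd : WeierstrassCurve ℚ) [Wd.IsElliptic] [Wd.IsGloballyMinimal] (C : VariableChange ℚ) (hC : C • W.quadraticTwist (d : ℚ) = Wd) :
    DoorUnitValueAt W d :=
  doorUnitValueAt_of_pureCycle_goodAtTwo hGV hE W h2 hirr hfW (hu.away _)
    (padicValRat_le_neg_one_of_isMinusSymbolUnit hfW.1 hfW.coeffField_eq_bot hu) hq₀ hq₀o hq₀N ha₀ ha₀o hη a hd0 hsq hd4 hgcd hpr
    hpure Wd C hC

/-- **AN-33p″ ⇒ AN-33p′ (PROVED):** the valuation clause of `EggHalfOddSymbolLawAtTwo` is automatic (AN-33w) and its good-at-`2` hypothesis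
is not used by `EggEtaOneLawAtTwo`. -/
theorem eggHalfOddSymbolLawAtTwo_of_eggEtaOneLaw (h : EggEtaOneLawAtTwo) : EggHalfOddSymbolLawAtTwo := by
  intro W _ _ _ hCM hsurj htor htam hrk hΔ hegg hSha _h2 N _ f hfW
  obtain ⟨u, hu, q₀, a₀, z₀, hq₀, hq₀o, hq₀N, ha₀, ha₀o, hz₀⟩ := h W hCM hsurj htor htam hrk hΔ hegg hSha N f hfW
  exact ⟨u, hu, padicValRat_le_neg_one_of_isMinusSymbolUnit hfW.1 hfW.coeffField_eq_bot hu, q₀, a₀, z₀, hq₀, hq₀o, hq₀N, ha₀,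
    ha₀o, hz₀⟩

/-- **AN-33x (PROVED glue): the bare parity bit `EggEtaOneLawAtTwo` + `hGV` + modularity ⇒ every admissible pure-`3`-cycle door of an
egg-class slice curve with good reduction at `2` is a unit door.**  Hence `hSup` on the egg ∧ good-at-`2` sub-slice ⟸ `η_f = 1` (AN-33p″)
+ `hGV` + `hasEntireLFunction_rat` + ONE door-admissible pure-`3`-cycle `d_K` per curve. -/
theorem doorUnitValueAt_of_eggEtaOneLaw (hP : EggEtaOneLawAtTwo)
    (hGV : numRealComponents_mul_imaginaryPeriodRat_eq_unit_mul_minusPeriod_two) (hE : hasEntireLFunction_rat)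
    (W : WeierstrassCurve ℚ) [W.IsElliptic] [W.IsGloballyMinimal] [NeZero (W.conductorNorm ℤ)]
    (hCM : ¬ W.HasCM) (hsurj : ∀ n : ℕ, W.HasSurjectiveModNGaloisRep ((2 ^ n : ℕ) : ℤ)) (htor : Odd W.torsionOrder)
    (htam : Odd W.tamagawaProduct) (hrk : W.analyticRank = 1) (hΔ : 0 < W.Δ) (hegg : MeetsEgg W) (hSha : ShaTwoTrivial W) (h2 : W.HasGoodReductionAtPrime 2)
    (g : CuspForm (Gamma0 (W.conductorNorm ℤ)) 2) (hgW : IsNewformOf W g)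
    {d : ℤ} (hd0 : d < 0) (hsq : Squarefree d) (hd4 : d % 4 = 1) (hgcd : Int.gcd d (W.conductorNorm ℤ) = 1)
    (hpure : ∀ q ∈ d.natAbs.primeFactors, Odd (W.LFunction q))
    (Wd : WeierstrassCurve ℚ) [Wd.IsElliptic] [Wd.IsGloballyMinimal] (C : VariableChange ℚ) (hC : C • W.quadraticTwist (d : ℚ) = Wd) :
    DoorUnitValueAt W d :=
  doorUnitValueAt_of_eggHalfOddSymbolLaw (eggHalfOddSymbolLawAtTwo_of_eggEtaOneLaw hP) hGV hE W hCM hsurj htor htam hrk hΔ hegg hSha h2 g hgW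
    hd0 hsq hd4 hgcd hpure Wd C hC

end UnitValuation

/-! ### §12 AN-33y/z (v32): the CANONICAL unit `u = ½` away from the level; `η_f` is the bit «`2F_{q₀}(f)` odd»

For `r = b/d` in lowest terms with `gcd(d, N) = 1` there is `γ = (a b; −cN d) ∈ Γ₀(N)` with `γ0 = r`; Manin's relation
`{∞, γ0}_f = {∞, γ∞}_f + {∞, 0}_f` (`modularSymbol_gamma0_smul_holds`), `im {∞, 0}_f = 0` (`[0]⁻ = 0`) and `im Λ_f = ℤ·Ω⁻_f/2` give
`[r]⁻_f ∈ ½ℤ` (AN-33y).  So `½` is a unit away from `N` and §4–§10 apply with `u = ½`: the door theorem needs only the canonical bit, and the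
exact valuation is `v₂(L(Wd,1)/Ω(Wd)) = 1 + v₂(½) = 0` (AN-33z′). -/

section Canonical

open Finset Literature.NumberTheory.QuadraticFields

open scoped NumberTheorySymbols

variable {N : ℕ} [NeZero N] {f : CuspForm (Gamma0 N) 2}

/-- `im {∞, 0}_f = 0` for a form with real coefficients (`[0]⁻_f = 0`). -/
theorem im_modularSymbol_zero (hQ : coeffField f = ⊥) : (modularSymbol f 0).im = 0 := by
  have hreal : ∀ n, (cuspCoeff f n).im = 0 := cuspCoeff_im_eq_zero_of_coeffField_eq_bot hQ
  have hM := minusSymbol_eq_im_mul_I_holds f hreal 0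
  have h0 : minusSymbol f 0 = 0 := by simp [minusSymbol]
  have := congrArg Complex.im (hM.symm.trans h0)
  simpa using this

/-- **AN-33y (PROVED): every minus symbol `[r]⁻_f` with denominator coprime to the level lies in `½ℤ`.** -/
theorem exists_int_ratMinusSymbol_eq_div_two (hf : IsNewform0 f) (hQ : coeffField f = ⊥) (r : ℚ)
    (hr : r.den.Coprime N) : ∃ z : ℤ, ratMinusSymbol f r = (z : ℚ) / 2 := by
  have hpos : 0 < minusPeriod f := IsNewform0.minusPeriod_pos_holds hf hQ
  have him : imagPeriods f = AddSubgroup.zmultiples (minusPeriod f / 2) := by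
    rcases minusPeriod_eq_zero_or f with h | ⟨-, h⟩
    · exact absurd h hpos.ne'
    · exact h
  have hcopN : Nat.Coprime r.den (r.num.natAbs * N) := Nat.Coprime.mul_right r.reduced.symm hr
  have hcop : IsCoprime (r.den : ℤ) (r.num * N) := by
    rw [Int.isCoprime_iff_gcd_eq_one, Int.gcd_eq_natAbs, Int.natAbs_mul, Int.natAbs_natCast, Int.natAbs_natCast]
    exact hcopN
  obtain ⟨a, c, hac⟩ := hcop
  let M : Matrix (Fin 2) (Fin 2) ℤ := !![a, r.num; -(c * N), (r.den : ℤ)]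
  have hdet : M.det = 1 := by
    rw [Matrix.det_fin_two_of]
    linear_combination hac
  let γ : SL(2, ℤ) := ⟨M, hdet⟩
  have h00 : (γ : Matrix (Fin 2) (Fin 2) ℤ) 0 0 = a := rfl
  have h01 : (γ : Matrix (Fin 2) (Fin 2) ℤ) 0 1 = r.num := rfl
  have h10 : (γ : Matrix (Fin 2) (Fin 2) ℤ) 1 0 = -(c * N) := rfl
  have h11 : (γ : Matrix (Fin 2) (Fin 2) ℤ) 1 1 = (r.den : ℤ) := rfl
  have hγ0 : γ ∈ Gamma0 N := by
    rw [Gamma0_mem]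
    show (((γ : Matrix (Fin 2) (Fin 2) ℤ) 1 0 : ℤ) : ZMod N) = 0
    rw [h10]; push_cast; simp
  have hne : (((⟨γ, hγ0⟩ : Gamma0 N) : SL(2, ℤ)) 1 0 : ℚ) * 0 + (((⟨γ, hγ0⟩ : Gamma0 N) : SL(2, ℤ)) 1 1 : ℚ) ≠ 0 := by
    show (((γ : Matrix (Fin 2) (Fin 2) ℤ) 1 0 : ℤ) : ℚ) * 0 + (((γ : Matrix (Fin 2) (Fin 2) ℤ) 1 1 : ℤ) : ℚ) ≠ 0
    rw [h10, h11, mul_zero, zero_add]; exact_mod_cast r.den_nz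
  have H := modularSymbol_gamma0_smul_holds f ⟨γ, hγ0⟩ 0 hne
  have hlhs : ((((⟨γ, hγ0⟩ : Gamma0 N) : SL(2, ℤ)) 0 0 : ℚ) * 0 + (((⟨γ, hγ0⟩ : Gamma0 N) : SL(2, ℤ)) 0 1 : ℚ)) /
      ((((⟨γ, hγ0⟩ : Gamma0 N) : SL(2, ℤ)) 1 0 : ℚ) * 0 + (((⟨γ, hγ0⟩ : Gamma0 N) : SL(2, ℤ)) 1 1 : ℚ)) = r := by
    show ((((γ : Matrix (Fin 2) (Fin 2) ℤ) 0 0 : ℤ) : ℚ) * 0 + (((γ : Matrix (Fin 2) (Fin 2) ℤ) 0 1 : ℤ) : ℚ)) /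
      ((((γ : Matrix (Fin 2) (Fin 2) ℤ) 1 0 : ℤ) : ℚ) * 0 + (((γ : Matrix (Fin 2) (Fin 2) ℤ) 1 1 : ℤ) : ℚ)) = r
    rw [h00, h01, h10, h11, mul_zero, zero_add, mul_zero, zero_add]
    exact_mod_cast Rat.num_div_den r
  rw [hlhs] at H
  have hmemΛ : cuspSymbol f ⟨γ, hγ0⟩ ∈ periodLattice f := cuspSymbol_mem_periodLattice f _
  have hmem : (cuspSymbol f ⟨γ, hγ0⟩).im ∈ imagPeriods f := by
    unfold imagPeriods
    exact AddSubgroup.mem_map.mpr ⟨_, hmemΛ, rfl⟩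
  rw [him] at hmem
  obtain ⟨k, hk⟩ := AddSubgroup.mem_zmultiples_iff.mp hmem
  refine ⟨k, ?_⟩
  have h3 : ((ratMinusSymbol f r : ℚ) : ℝ) * minusPeriod f = ((k : ℝ) / 2) * minusPeriod f := by
    rw [← im_modularSymbol_eq hf hQ r, H, Complex.add_im, im_modularSymbol_zero hQ, add_zero, ← hk, zsmul_eq_mul]
    ring
  have h4 := mul_right_cancel₀ hpos.ne' h3
  have h5 : ((ratMinusSymbol f r : ℚ) : ℝ) = (((k : ℚ) / 2 : ℚ) : ℝ) := by push_cast; linarith [h4]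
  exact Rat.cast_injective h5

/-- **AN-33y′ (PROVED): `½` is a minus-symbol unit away from the level `N`.** -/
theorem isMinusSymbolUnitAway_half (hf : IsNewform0 f) (hQ : coeffField f = ⊥) : IsMinusSymbolUnitAway f N (1 / 2) := by
  refine ⟨by norm_num, fun r hr => ?_⟩
  obtain ⟨z, hz⟩ := exists_int_ratMinusSymbol_eq_div_two hf hQ r hr
  exact ⟨z, by rw [hz]; ring⟩

/-- -an g16 helper (Sketch_v37, proofs port; kernel-checked). -/
theorem padicValRat_two_half : padicValRat 2 (1 / 2 : ℚ) = -1 := by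
  haveI : Fact (Nat.Prime 2) := ⟨Nat.prime_two⟩
  rw [padicValRat.div one_ne_zero two_ne_zero, padicValRat.one]
  have h22 : padicValRat 2 (2 : ℚ) = 1 := by
    have := padicValRat.self (p := 2) one_lt_two
    simpa using this
  rw [h22]; norm_num

/-- **The canonical bit from any all-`r` unit bit (PROVED):** if `F_{q₀} ∈ (2ℤ+1)·u` for an all-`r` symbol unit `u`, then `2F_{q₀}` is odd
(`½ = m·u` by AN-33w and `F_{q₀} ∈ ½ℤ` by AN-33y force `m` odd). -/
theorem exists_int_minusHalfSum_eq_odd_div_two_of_unit (hf : IsNewform0 f) (hQ : coeffField f = ⊥) {u : ℚ} (hu : IsMinusSymbolUnit f u)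
    {q₀ : ℕ} (hq₀ : q₀.Prime) (hq₀N : ¬ q₀ ∣ N) (hη : ∃ z₀ : ℤ, minusHalfSum f q₀ = (2 * z₀ + 1) * u) :
    ∃ z₀ : ℤ, minusHalfSum f q₀ = (2 * z₀ + 1) / 2 := by
  obtain ⟨m, hm⟩ := exists_int_mul_eq_half_of_isMinusSymbolUnit hf hQ hu
  obtain ⟨y, hy⟩ := exists_int_minusHalfSum_eq_mul_away (isMinusSymbolUnitAway_half hf hQ) q₀
    ((Nat.Prime.coprime_iff_not_dvd hq₀).mpr hq₀N)
  obtain ⟨z₀, hz₀⟩ := hη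
  have hu0 : u ≠ 0 := ne_of_gt hu.1
  have e2 : ((2 * (z₀ : ℚ) + 1)) * u = ((m : ℚ) * y) * u := by
    rw [← hz₀, hy]; linear_combination (-(y : ℚ)) * hm
  have e3 := mul_right_cancel₀ hu0 e2
  have key : (2 * z₀ + 1 : ℤ) = m * y := by exact_mod_cast e3
  have hmy : Odd (m * y) := ⟨z₀, key.symm⟩
  obtain ⟨w, hw⟩ := (Int.odd_mul.mp hmy).2
  exact ⟨w, by rw [hy, hw]; push_cast; ring⟩

/-- **AN-33p″ ⇒ AN-33p‴ (PROVED):** the all-`r`-unit form of the parity bit implies the canonical form. -/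
theorem eggTwiceHalfSumOddLawAtTwo_of_eggEtaOneLaw (h : EggEtaOneLawAtTwo) : EggTwiceHalfSumOddLawAtTwo := by
  intro W _ _ _ hCM hsurj htor htam hrk hΔ hegg hSha N _ f hfW
  obtain ⟨u, hu, q₀, a₀, z₀, hq₀, hq₀o, hq₀N, ha₀, ha₀o, hz₀⟩ := h W hCM hsurj htor htam hrk hΔ hegg hSha N f hfW
  obtain ⟨w, hw⟩ := exists_int_minusHalfSum_eq_odd_div_two_of_unit hfW.1 hfW.coeffField_eq_bot hu hq₀ hq₀N ⟨z₀, hz₀⟩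
  exact ⟨q₀, a₀, w, hq₀, hq₀o, hq₀N, ha₀, ha₀o, hw⟩

/-- **AN-33z (PROVED): the CANONICAL door theorem.**  `W` globally minimal with good reduction at `2` and `ρ̄_{W,2}` irreducible, `f` its
newform of level `N`; ONE `3`-cycle prime `q₀ ∤ N` with `2F_{q₀}(f)` odd.  Then every admissible pure-`3`-cycle door `d` (`d < 0` square-free,
`d ≡ 1 (4)`, `gcd(d, N_W) = 1`, all prime factors `q ∤ N` with `a_q` odd) is a unit door in value currency: `L(W^{(d)},1) ≠ 0` and for ANY
globally minimal model `Wd` of the twist `L(Wd,1)/Ω(Wd) ∈ ℚ` with `v₂ ≤ t(d) + 2s(d)` (indeed `= 0`, AN-33z′) — modulo the named fact `hGV`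
and modularity `hE`; no unit, period, model or valuation hypothesis. -/
theorem doorUnitValueAt_of_pureCycle_canonical_of_periodUnit
    (hE : hasEntireLFunction_rat)
    (W : WeierstrassCurve ℚ) [W.IsElliptic] [W.IsGloballyMinimal] (hfW : IsNewformOf W f)
    (hw : ∃ w : ℚ, ‖(w : ℚ_[2])‖ = 1 ∧ ((W.baseChange ℝ).numRealComponents : ℝ) * W.imaginaryPeriodRat = w * minusPeriod f)
    {q₀ : ℕ} {a₀ : ℤ} (hq₀ : q₀.Prime) (hq₀o : Odd q₀) (hq₀N : ¬ q₀ ∣ N) (ha₀ : cuspCoeff f q₀ = (a₀ : ℂ)) (ha₀o : Odd a₀)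
    (hη : ∃ z₀ : ℤ, minusHalfSum f q₀ = (2 * z₀ + 1) / 2)
    (a : ℕ → ℤ) {d : ℤ} (hd0 : d < 0) (hsq : Squarefree d) (hd4 : d % 4 = 1) (hgcd : Int.gcd d (W.conductorNorm ℤ) = 1)
    (hpr : ∀ q ∈ d.natAbs.primeFactors, ¬ q ∣ N ∧ cuspCoeff f q = (a q : ℂ)) (hpure : ∀ q ∈ d.natAbs.primeFactors, Odd (a q))
    (Wd : WeierstrassCurve ℚ) [Wd.IsElliptic] [Wd.IsGloballyMinimal] (C : VariableChange ℚ) (hC : C • W.quadraticTwist (d : ℚ) = Wd) :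
    DoorUnitValueAt W d := by
  have hη' : ∃ z₀ : ℤ, minusHalfSum f q₀ = (2 * z₀ + 1) * (1 / 2 : ℚ) := by
    obtain ⟨z₀, hz₀⟩ := hη; exact ⟨z₀, by rw [hz₀]; ring⟩
  exact doorUnitValueAt_of_pureCycle_of_periodUnit hE W hfW hw (isMinusSymbolUnitAway_half hfW.1 hfW.coeffField_eq_bot)
    (by rw [padicValRat_two_half]) hq₀ hq₀o hq₀N ha₀ ha₀o hη' a hd0 hsq hd4 hgcd hpr hpure Wd C hC

/-- (v35) The `2 ∤ N` case via the named fact `hGV` — original statement, now a corollary of `doorUnitValueAt_of_pureCycle_canonical_of_periodUnit`. -/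
theorem doorUnitValueAt_of_pureCycle_goodAtTwo_canonical
    (hGV : numRealComponents_mul_imaginaryPeriodRat_eq_unit_mul_minusPeriod_two) (hE : hasEntireLFunction_rat)
    (W : WeierstrassCurve ℚ) [W.IsElliptic] [W.IsGloballyMinimal]
    (h2 : W.HasGoodReductionAtPrime 2) (hirr : W.HasIrreducibleModPGaloisRep 2) (hfW : IsNewformOf W f)
    {q₀ : ℕ} {a₀ : ℤ} (hq₀ : q₀.Prime) (hq₀o : Odd q₀) (hq₀N : ¬ q₀ ∣ N) (ha₀ : cuspCoeff f q₀ = (a₀ : ℂ)) (ha₀o : Odd a₀)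
    (hη : ∃ z₀ : ℤ, minusHalfSum f q₀ = (2 * z₀ + 1) / 2)
    (a : ℕ → ℤ) {d : ℤ} (hd0 : d < 0) (hsq : Squarefree d) (hd4 : d % 4 = 1) (hgcd : Int.gcd d (W.conductorNorm ℤ) = 1)
    (hpr : ∀ q ∈ d.natAbs.primeFactors, ¬ q ∣ N ∧ cuspCoeff f q = (a q : ℂ)) (hpure : ∀ q ∈ d.natAbs.primeFactors, Odd (a q))
    (Wd : WeierstrassCurve ℚ) [Wd.IsElliptic] [Wd.IsGloballyMinimal] (C : VariableChange ℚ) (hC : C • W.quadraticTwist (d : ℚ) = Wd) :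
    DoorUnitValueAt W d :=
  doorUnitValueAt_of_pureCycle_canonical_of_periodUnit hE W hfW (hGV W h2 hirr f hfW) hq₀ hq₀o hq₀N ha₀ ha₀o hη a hd0 hsq hd4 hgcd hpr hpure Wd C hC

/-- **AN-33z′ (PROVED): at such doors `L(Wd,1)/Ω(Wd)` is a `2`-ADIC UNIT** (`v₂ = 1 + v₂(½) = 0` exactly, door-independent). -/
theorem padicValRat_value_div_period_eq_zero_canonical_of_periodUnit
    (hE : hasEntireLFunction_rat)
    (W : WeierstrassCurve ℚ) [W.IsElliptic] [W.IsGloballyMinimal] (hfW : IsNewformOf W f)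
    (hw : ∃ w : ℚ, ‖(w : ℚ_[2])‖ = 1 ∧ ((W.baseChange ℝ).numRealComponents : ℝ) * W.imaginaryPeriodRat = w * minusPeriod f)
    {q₀ : ℕ} {a₀ : ℤ} (hq₀ : q₀.Prime) (hq₀o : Odd q₀) (hq₀N : ¬ q₀ ∣ N) (ha₀ : cuspCoeff f q₀ = (a₀ : ℂ)) (ha₀o : Odd a₀)
    (hη : ∃ z₀ : ℤ, minusHalfSum f q₀ = (2 * z₀ + 1) / 2)
    (a : ℕ → ℤ) {d : ℤ} (hd0 : d < 0) (hsq : Squarefree d) (hd4 : d % 4 = 1) (hgcd : Int.gcd d (W.conductorNorm ℤ) = 1)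
    (hpr : ∀ q ∈ d.natAbs.primeFactors, ¬ q ∣ N ∧ cuspCoeff f q = (a q : ℂ)) (hpure : ∀ q ∈ d.natAbs.primeFactors, Odd (a q))
    (Wd : WeierstrassCurve ℚ) [Wd.IsGloballyMinimal] (C : VariableChange ℚ) (hC : C • W.quadraticTwist (d : ℚ) = Wd) :
    ∃ qd : ℚ, Wd.entireLFunction 1 / (Wd.realPeriodRat : ℂ) = (qd : ℂ) ∧ padicValRat 2 qd = 0 := by
  have hu := isMinusSymbolUnitAway_half hfW.1 hfW.coeffField_eq_bot
  set D : ℕ := d.natAbs with hDdef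
  haveI : NeZero D := ⟨Int.natAbs_ne_zero.mpr hsq.ne_zero⟩
  have hD3 : D % 4 = 3 := by omega
  have hDsq : Squarefree D := Int.squarefree_natAbs.mpr hsq
  have hDodd : Odd D := Nat.odd_iff.mpr (by omega)
  have hD1 : 1 < D := by omega
  have hχo : (jacobiChar D).Odd := jacobiChar_neg_one_of_mod_four_eq_three hD3
  have hq : ∀ x : (ZMod D)ˣ, jacobiChar D x = 1 ∨ jacobiChar D x = -1 := by
    intro x
    rcases isQuadratic_jacobiChar (q := D) (x : ZMod D) with h0 | h1 | h2
    · exact absurd ((Units.isUnit x).map (jacobiChar D)) (by rw [h0]; exact not_isUnit_zero)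
    · exact Or.inl h1
    · exact Or.inr h2
  obtain ⟨z, hz⟩ := (twistedMinusSymbolSum_unitClassLaw f hfW.1 hfW.coeffField_eq_bot hu hq₀ hq₀o hq₀N
    ((Nat.Prime.coprime_iff_not_dvd hq₀).mpr hq₀N) ha₀ ha₀o a hDsq hDodd
    (coprime_of_primeFactors_not_dvd (NeZero.ne D) fun q hq' => (hpr q hq').1) hpr (jacobiChar D) hχo hq).1 ⟨hD1, hpure⟩
  obtain ⟨z₀, hz₀⟩ := hη
  have hS : ∃ w : ℤ, ratMinusTwistedSymbolSum f (jacobiChar D) = (((2 : ℚ) * (2 * w + 1) * (1 / 2 : ℚ) : ℚ) : ℂ) := by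
    refine ⟨z₀ + z, ?_⟩
    rw [hz, hz₀]; push_cast; ring
  obtain ⟨qd, hqd, hv⟩ := exists_rat_value_div_period_of_unitClass_of_periodUnit hE W hfW hw hd0 hsq hd4 hgcd Wd C hC
    (by norm_num : (1 / 2 : ℚ) ≠ 0) hS
  exact ⟨qd, hqd, by rw [hv, padicValRat_two_half]; norm_num⟩

/-- (v35) The `2 ∤ N` case via the named fact `hGV` — original statement, now a corollary of `padicValRat_value_div_period_eq_zero_canonical_of_periodUnit`. -/
theorem padicValRat_value_div_period_eq_zero_canonical
    (hGV : numRealComponents_mul_imaginaryPeriodRat_eq_unit_mul_minusPeriod_two) (hE : hasEntireLFunction_rat)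
    (W : WeierstrassCurve ℚ) [W.IsElliptic] [W.IsGloballyMinimal]
    (h2 : W.HasGoodReductionAtPrime 2) (hirr : W.HasIrreducibleModPGaloisRep 2) (hfW : IsNewformOf W f)
    {q₀ : ℕ} {a₀ : ℤ} (hq₀ : q₀.Prime) (hq₀o : Odd q₀) (hq₀N : ¬ q₀ ∣ N) (ha₀ : cuspCoeff f q₀ = (a₀ : ℂ)) (ha₀o : Odd a₀)
    (hη : ∃ z₀ : ℤ, minusHalfSum f q₀ = (2 * z₀ + 1) / 2)
    (a : ℕ → ℤ) {d : ℤ} (hd0 : d < 0) (hsq : Squarefree d) (hd4 : d % 4 = 1) (hgcd : Int.gcd d (W.conductorNorm ℤ) = 1)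
    (hpr : ∀ q ∈ d.natAbs.primeFactors, ¬ q ∣ N ∧ cuspCoeff f q = (a q : ℂ)) (hpure : ∀ q ∈ d.natAbs.primeFactors, Odd (a q))
    (Wd : WeierstrassCurve ℚ) [Wd.IsGloballyMinimal] (C : VariableChange ℚ) (hC : C • W.quadraticTwist (d : ℚ) = Wd) :
    ∃ qd : ℚ, Wd.entireLFunction 1 / (Wd.realPeriodRat : ℂ) = (qd : ℂ) ∧ padicValRat 2 qd = 0 :=
  padicValRat_value_div_period_eq_zero_canonical_of_periodUnit hE W hfW (hGV W h2 hirr f hfW) hq₀ hq₀o hq₀N ha₀ ha₀o hη a hd0 hsq hd4 hgcd hpr hpure Wd C hC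

/-- **AN-33x‴ (PROVED glue): the canonical bit `EggTwiceHalfSumOddLawAtTwo` + `hGV` + modularity ⇒ every admissible pure-`3`-cycle door of an
egg-class slice curve with good reduction at `2` is a unit door** (newform at level `N_W`). -/
theorem doorUnitValueAt_of_eggTwiceHalfSumOddLaw (hP : EggTwiceHalfSumOddLawAtTwo)
    (hGV : numRealComponents_mul_imaginaryPeriodRat_eq_unit_mul_minusPeriod_two) (hE : hasEntireLFunction_rat)
    (W : WeierstrassCurve ℚ) [W.IsElliptic] [W.IsGloballyMinimal] [NeZero (W.conductorNorm ℤ)]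
    (hCM : ¬ W.HasCM) (hsurj : ∀ n : ℕ, W.HasSurjectiveModNGaloisRep ((2 ^ n : ℕ) : ℤ)) (htor : Odd W.torsionOrder)
    (htam : Odd W.tamagawaProduct) (hrk : W.analyticRank = 1) (hΔ : 0 < W.Δ) (hegg : MeetsEgg W) (hSha : ShaTwoTrivial W) (h2 : W.HasGoodReductionAtPrime 2)
    (g : CuspForm (Gamma0 (W.conductorNorm ℤ)) 2) (hgW : IsNewformOf W g)
    {d : ℤ} (hd0 : d < 0) (hsq : Squarefree d) (hd4 : d % 4 = 1) (hgcd : Int.gcd d (W.conductorNorm ℤ) = 1)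
    (hpure : ∀ q ∈ d.natAbs.primeFactors, Odd (W.LFunction q))
    (Wd : WeierstrassCurve ℚ) [Wd.IsElliptic] [Wd.IsGloballyMinimal] (C : VariableChange ℚ) (hC : C • W.quadraticTwist (d : ℚ) = Wd) :
    DoorUnitValueAt W d := by
  obtain ⟨q₀, a₀, z₀, hq₀, hq₀o, hq₀N, ha₀, ha₀o, hz₀⟩ := hP W hCM hsurj htor htam hrk hΔ hegg hSha (W.conductorNorm ℤ) g hgW
  haveI : NeZero ((2 : ℕ) : ℚ) := ⟨by norm_num⟩
  have hirr : W.HasIrreducibleModPGaloisRep 2 :=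
    hasIrreducibleModPGaloisRep_of_hasSurjectiveModNGaloisRep W 2 (by simpa using hsurj 1)
  have hpr : ∀ q ∈ d.natAbs.primeFactors, ¬ q ∣ W.conductorNorm ℤ ∧ cuspCoeff g q = ((W.LFunction q : ℤ) : ℂ) := by
    intro q hq
    have hqp : q.Prime := Nat.prime_of_mem_primeFactors hq
    have hqd : q ∣ d.natAbs := Nat.dvd_of_mem_primeFactors hq
    refine ⟨fun hqN => ?_, hgW.2 q⟩
    have h1 : q ∣ Int.gcd d (W.conductorNorm ℤ) := by
      rw [Int.gcd_eq_natAbs]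
      exact Nat.dvd_gcd hqd (by simpa using hqN)
    rw [hgcd] at h1
    exact hqp.one_lt.ne' (Nat.dvd_one.mp h1)
  exact doorUnitValueAt_of_pureCycle_goodAtTwo_canonical hGV hE W h2 hirr hgW hq₀ hq₀o hq₀N ha₀ ha₀o ⟨z₀, hz₀⟩
    (fun q => W.LFunction q) hd0 hsq hd4 hgcd hpr hpure Wd C hC

end Canonical

end Summit.BirchSwinnertonDyer.Rank1Residual.F1Sign2.ANg16
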